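import Summits.AnomalousDissipation.AnomalousDissipation.Theorems.MomentParityQuarticGateRealize
import Summits.AnomalousDissipation.AnomalousDissipation.Theorems.MomentParityQuarticGatePolyCalc

/-!
# Slater ⟺ strict positivity of the coordinate moments (infrastructure I6 for
`MomentParity.QuarticGate`, line `recession-cone`, stmt-AnomalousDissipation-11464)

The crux phrases the Slater condition of a level-`N` law `μ` in BAND FORM: every cylindrical
polynomial `P((u,g₁),…,(u,gₘ))` of total degree `≤ 4` over level-`N` band tests which is `≥ 0` on
level-`N` fields and not identically zero there has `∫ P dμ > 0`. In an orthonormal band basis `b`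
(bundle `hb`, `hbo`, `hbs`) this is exactly strict positivity in degree `4`
(`Literature.MeasureTheory.Moments.IsStrictlyKPositive univ 4`) of the COORDINATE MOMENTS
`y_α = ∫ ∏ᵢ (u,bᵢ)^{αᵢ} dμ`:

* `integrable_prod_coord_pow`, `integrable_eval_coords_of_four` / `integral_eval_coords_eq_rieszFunctional` —
  monomials of degree `≤ 4` in the coordinates are integrable when `∫ ‖u‖⁴ dμ < ∞`, and
  `∫ Q(x) dμ = L_y(Q)`;
* `isStrictlyKPositive_of_slater` (band Slater ⟹ strict positivity; take `g := b`);
* `slater_of_isStrictlyKPositive` (converse; substitute the coordinate forms of the pairings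
  `(u, gⱼ) = Σₗ (gⱼ, bₗ) xₗ` into `P`).
-/

namespace Summit.AnomalousDissipation.AnomalousDissipation.Theorems.MomentParityQuarticGate

open MeasureTheory Filter MvPolynomial
open scoped InnerProductSpace RealInnerProductSpace ENNReal
open Literature.Analysis.FunctionSpaces Literature.Analysis.FluidPDE
open Literature.MeasureTheory.Moments
open Summit.AnomalousDissipation.AnomalousDissipation.Theses.MomentParity

set_option linter.dupNamespace false

variable {N n : ℕ} {b : Fin n → UnitAddTorus (Fin 3) → EuclideanSpace ℝ (Fin 3)}

/-! ## Coordinate monomials of degree `≤ 4` are integrable -/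

/-- `t ^ p ≤ 1 + t ^ 4` for `0 ≤ t` and `p ≤ 4`. [folklore] -/
theorem pow_le_one_add_pow_four {t : ℝ} (ht : 0 ≤ t) {p : ℕ} (hp : p ≤ 4) : t ^ p ≤ 1 + t ^ 4 := by
  rcases le_total t 1 with h | h
  · exact (pow_le_one₀ ht h).trans (le_add_of_nonneg_right (by positivity))
  · exact (pow_le_pow_right₀ h hp).trans (le_add_of_nonneg_left zero_le_one)

/-- A coordinate monomial of degree `≤ 4` is dominated by `1 + ‖u‖⁴`. [folklore] -/
theorem abs_prod_coord_pow_le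
    (hb : ∀ i, Torus.IsSmooth (b i) ∧ Torus.IsDivFree (b i) ∧ Torus.HasZeroMean (b i) ∧
      ∀ k ∉ (Torus.freqBall N).erase (0 : Fin 3 → ℤ),
        UnitAddTorus.mFourierCoeff (EuclideanSpace.complexify ∘ (b i)) k = 0)
    (hbo : ∀ i j, ∫ x, ⟪b i x, b j x⟫_ℝ = if i = j then (1 : ℝ) else 0)
    {α : Fin n →₀ ℕ} (hα : (α.sum fun _ e => e) ≤ 4) (u : Torus.energySpace (Fin 3)) :
    |∏ i, (Torus.pairing u.1 (b i)) ^ α i| ≤ 1 + ‖u‖ ^ 4 := by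
  rw [Finset.abs_prod]
  simp_rw [abs_pow]
  have h1 : ∏ i, |Torus.pairing u.1 (b i)| ^ α i ≤ ∏ i, ‖u‖ ^ α i :=
    Finset.prod_le_prod (fun i _ => by positivity) fun i _ =>
      pow_le_pow_left₀ (abs_nonneg _) (abs_coord_le_norm hb hbo u i) _
  refine h1.trans ?_
  rw [Finset.prod_pow_eq_pow_sum]
  refine pow_le_one_add_pow_four (norm_nonneg u) ?_
  simpa [Finsupp.sum_fintype] using hα

/-- Coordinate monomials of degree `≤ 4` are integrable against a finite law with `∫ ‖u‖⁴ < ∞`.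
[folklore] -/
theorem integrable_prod_coord_pow
    (hb : ∀ i, Torus.IsSmooth (b i) ∧ Torus.IsDivFree (b i) ∧ Torus.HasZeroMean (b i) ∧
      ∀ k ∉ (Torus.freqBall N).erase (0 : Fin 3 → ℤ),
        UnitAddTorus.mFourierCoeff (EuclideanSpace.complexify ∘ (b i)) k = 0)
    (hbo : ∀ i j, ∫ x, ⟪b i x, b j x⟫_ℝ = if i = j then (1 : ℝ) else 0)
    {μ : Measure (Torus.energySpace (Fin 3))} [IsFiniteMeasure μ]
    (h4 : Integrable (fun u : Torus.energySpace (Fin 3) => ‖u‖ ^ 4) μ)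
    {α : Fin n →₀ ℕ} (hα : (α.sum fun _ e => e) ≤ 4) :
    Integrable (fun u : Torus.energySpace (Fin 3) => ∏ i, (Torus.pairing u.1 (b i)) ^ α i) μ := by
  have hc : Continuous fun u : Torus.energySpace (Fin 3) => ∏ i, (Torus.pairing u.1 (b i)) ^ α i :=
    continuous_finsetProd _ fun i _ => (Torus.continuous_pairing_coe ((hb i).1.memLp 2)).pow _
  refine Integrable.mono' ((integrable_const (1 : ℝ)).add h4) hc.aestronglyMeasurable
    (ae_of_all _ fun u => ?_)
  rw [Real.norm_eq_abs]
  exact abs_prod_coord_pow_le hb hbo hα u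

/-- **Integrating a coordinate polynomial**: for `Q` of total degree `≤ 4`, `u ↦ Q((u,bᵢ)ᵢ)` is
integrable and `∫ Q((u,bᵢ)ᵢ) dμ = L_y(Q)` with `y` the coordinate moments of `μ`. [folklore] -/
theorem integrable_eval_coords_of_four
    (hb : ∀ i, Torus.IsSmooth (b i) ∧ Torus.IsDivFree (b i) ∧ Torus.HasZeroMean (b i) ∧
      ∀ k ∉ (Torus.freqBall N).erase (0 : Fin 3 → ℤ),
        UnitAddTorus.mFourierCoeff (EuclideanSpace.complexify ∘ (b i)) k = 0)
    (hbo : ∀ i j, ∫ x, ⟪b i x, b j x⟫_ℝ = if i = j then (1 : ℝ) else 0)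
    {μ : Measure (Torus.energySpace (Fin 3))} [IsFiniteMeasure μ]
    (h4 : Integrable (fun u : Torus.energySpace (Fin 3) => ‖u‖ ^ 4) μ)
    (Q : MvPolynomial (Fin n) ℝ) (hQ : Q.totalDegree ≤ 4) :
    Integrable (fun u : Torus.energySpace (Fin 3) =>
        MvPolynomial.eval (fun i => Torus.pairing u.1 (b i)) Q) μ ∧
      ∫ u, MvPolynomial.eval (fun i => Torus.pairing u.1 (b i)) Q ∂μ =
        rieszFunctional (fun α => ∫ u, ∏ i, (Torus.pairing u.1 (b i)) ^ α i ∂μ) Q := by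
  have hdeg : ∀ α ∈ Q.support, (α.sum fun _ e => e) ≤ 4 := fun α hα =>
    (MvPolynomial.le_totalDegree hα).trans hQ
  have hfun : (fun u : Torus.energySpace (Fin 3) =>
      MvPolynomial.eval (fun i => Torus.pairing u.1 (b i)) Q) =
      fun u => ∑ α ∈ Q.support, MvPolynomial.coeff α Q * ∏ i, (Torus.pairing u.1 (b i)) ^ α i := by
    funext u
    exact MvPolynomial.eval_eq' _ Q
  have hint : ∀ α ∈ Q.support, Integrable (fun u : Torus.energySpace (Fin 3) =>
      MvPolynomial.coeff α Q * ∏ i, (Torus.pairing u.1 (b i)) ^ α i) μ :=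
    fun α hα => (integrable_prod_coord_pow hb hbo h4 (hdeg α hα)).const_mul _
  refine ⟨by rw [hfun]; exact integrable_finsetSum _ hint, ?_⟩
  rw [hfun, integral_finsetSum _ hint]
  unfold rieszFunctional
  refine Finset.sum_congr rfl fun α _ => ?_
  rw [integral_const_mul]

/-! ## I6 — band Slater versus strict positivity -/

/-- **I6a — band-form Slater ⟹ strict positivity of the coordinate moments.** (Take the basis
fields themselves as test fields; every `x ∈ ℝⁿ` is the coordinate vector of a level-`N` field.)
[folklore] -/
theorem isStrictlyKPositive_of_slater :
    ∀ {N n : ℕ} {b : Fin n → UnitAddTorus (Fin 3) → EuclideanSpace ℝ (Fin 3)},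
      (∀ i, Torus.IsSmooth (b i) ∧ Torus.IsDivFree (b i) ∧ Torus.HasZeroMean (b i) ∧
        ∀ k ∉ (Torus.freqBall N).erase (0 : Fin 3 → ℤ),
          UnitAddTorus.mFourierCoeff (EuclideanSpace.complexify ∘ (b i)) k = 0) →
      (∀ i j, ∫ x, ⟪b i x, b j x⟫_ℝ = if i = j then (1 : ℝ) else 0) →
      ∀ (μ : Measure (Torus.energySpace (Fin 3))), IsFiniteMeasure μ →
      Integrable (fun u : Torus.energySpace (Fin 3) => ‖u‖ ^ 4) μ →
      (∀ (m : ℕ) (g : Fin m → UnitAddTorus (Fin 3) → EuclideanSpace ℝ (Fin 3))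
        (P : MvPolynomial (Fin m) ℝ),
        (∀ i, (Torus.IsSmooth (g i) ∧ Torus.IsDivFree (g i) ∧ Torus.HasZeroMean (g i) ∧
          ∀ k ∉ (Torus.freqBall N).erase (0 : Fin 3 → ℤ),
            UnitAddTorus.mFourierCoeff (EuclideanSpace.complexify ∘ (g i)) k = 0)) → P.totalDegree ≤ 4 →
        (∀ u : Torus.energySpace (Fin 3), (∀ k ∉ (Torus.freqBall N).erase (0 : Fin 3 → ℤ),
            UnitAddTorus.mFourierCoeff (EuclideanSpace.complexify ∘ (u.1 : UnitAddTorus (Fin 3) → EuclideanSpace ℝ (Fin 3))) k = 0) →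
          0 ≤ MvPolynomial.eval (fun j => Torus.pairing u.1 (g j)) P) →
        (∃ u : Torus.energySpace (Fin 3), (∀ k ∉ (Torus.freqBall N).erase (0 : Fin 3 → ℤ),
            UnitAddTorus.mFourierCoeff (EuclideanSpace.complexify ∘ (u.1 : UnitAddTorus (Fin 3) → EuclideanSpace ℝ (Fin 3))) k = 0) ∧
          MvPolynomial.eval (fun j => Torus.pairing u.1 (g j)) P ≠ 0) →
        0 < ∫ u, MvPolynomial.eval (fun j => Torus.pairing u.1 (g j)) P ∂μ) →
      Literature.MeasureTheory.Moments.IsStrictlyKPositive (Set.univ : Set (Fin n → ℝ)) 4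
        (fun α => ∫ u, ∏ i, (Torus.pairing u.1 (b i)) ^ α i ∂μ) := by
  intro N n b hb hbo μ hμ h4 hS
  refine ⟨fun p hp hpos => ?_, fun p hp hpos hne => ?_⟩
  · rw [← (integrable_eval_coords_of_four hb hbo h4 p hp).2]
    exact integral_nonneg fun u => hpos _ (Set.mem_univ _)
  · rw [← (integrable_eval_coords_of_four hb hbo h4 p hp).2]
    obtain ⟨x, -, hx⟩ := hne
    obtain ⟨u, hu, hux, -⟩ := exists_level_of_coords hb hbo x
    refine hS n b p hb hp (fun v _ => hpos _ (Set.mem_univ _)) ⟨u, hu, ?_⟩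
    rwa [hux]

/-- **I6b — strict positivity of the coordinate moments ⟹ band-form Slater.** (Substitute the
coordinate forms `(u, gⱼ) = Σₗ (gⱼ, bₗ) xₗ` into `P`.) [folklore] -/
theorem slater_of_isStrictlyKPositive :
    ∀ {N n : ℕ} {b : Fin n → UnitAddTorus (Fin 3) → EuclideanSpace ℝ (Fin 3)},
      (∀ i, Torus.IsSmooth (b i) ∧ Torus.IsDivFree (b i) ∧ Torus.HasZeroMean (b i) ∧
        ∀ k ∉ (Torus.freqBall N).erase (0 : Fin 3 → ℤ),
          UnitAddTorus.mFourierCoeff (EuclideanSpace.complexify ∘ (b i)) k = 0) →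
      (∀ i j, ∫ x, ⟪b i x, b j x⟫_ℝ = if i = j then (1 : ℝ) else 0) →
      (∀ u : Torus.energySpace (Fin 3),
        (∀ k ∉ (Torus.freqBall N).erase (0 : Fin 3 → ℤ),
          UnitAddTorus.mFourierCoeff (EuclideanSpace.complexify ∘
            (u.1 : UnitAddTorus (Fin 3) → EuclideanSpace ℝ (Fin 3))) k = 0) →
        ∀ x, Torus.fourierTruncate N (u.1 : UnitAddTorus (Fin 3) → EuclideanSpace ℝ (Fin 3)) x =
          ∑ i, Torus.pairing u.1 (b i) • b i x) →
      ∀ (μ : Measure (Torus.energySpace (Fin 3))), IsFiniteMeasure μ →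
      Integrable (fun u : Torus.energySpace (Fin 3) => ‖u‖ ^ 4) μ →
      Literature.MeasureTheory.Moments.IsStrictlyKPositive (Set.univ : Set (Fin n → ℝ)) 4
        (fun α => ∫ u, ∏ i, (Torus.pairing u.1 (b i)) ^ α i ∂μ) →
      ∀ (m : ℕ) (g : Fin m → UnitAddTorus (Fin 3) → EuclideanSpace ℝ (Fin 3))
        (P : MvPolynomial (Fin m) ℝ),
        (∀ i, (Torus.IsSmooth (g i) ∧ Torus.IsDivFree (g i) ∧ Torus.HasZeroMean (g i) ∧
          ∀ k ∉ (Torus.freqBall N).erase (0 : Fin 3 → ℤ),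
            UnitAddTorus.mFourierCoeff (EuclideanSpace.complexify ∘ (g i)) k = 0)) → P.totalDegree ≤ 4 →
        (∀ u : Torus.energySpace (Fin 3), (∀ k ∉ (Torus.freqBall N).erase (0 : Fin 3 → ℤ),
            UnitAddTorus.mFourierCoeff (EuclideanSpace.complexify ∘ (u.1 : UnitAddTorus (Fin 3) → EuclideanSpace ℝ (Fin 3))) k = 0) →
          0 ≤ MvPolynomial.eval (fun j => Torus.pairing u.1 (g j)) P) →
        (∃ u : Torus.energySpace (Fin 3), (∀ k ∉ (Torus.freqBall N).erase (0 : Fin 3 → ℤ),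
            UnitAddTorus.mFourierCoeff (EuclideanSpace.complexify ∘ (u.1 : UnitAddTorus (Fin 3) → EuclideanSpace ℝ (Fin 3))) k = 0) ∧
          MvPolynomial.eval (fun j => Torus.pairing u.1 (g j)) P ≠ 0) →
        0 < ∫ u, MvPolynomial.eval (fun j => Torus.pairing u.1 (g j)) P ∂μ := by
  intro N n b hb hbo hbs μ hμ h4 hy m g P hg hP hpos hex
  -- the coordinate forms of the pairings `(u, g j)` and the substituted polynomial
  set ℓ : Fin m → MvPolynomial (Fin n) ℝ := fun j => ∑ l, C (∫ y, ⟪g j y, b l y⟫_ℝ) * X l with hℓ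
  have hℓh : ∀ j, (ℓ j).IsHomogeneous 1 := fun j => isHomogeneous_sum_C_mul_X _ _ _
  have hsub : ∀ u : Torus.energySpace (Fin 3),
      MvPolynomial.eval (fun j => Torus.pairing u.1 (g j)) P =
        MvPolynomial.eval (fun i => Torus.pairing u.1 (b i)) (bind₁ ℓ P) := by
    intro u
    have hfun : (fun j => Torus.pairing u.1 (g j)) =
        fun j => MvPolynomial.eval (fun i => Torus.pairing u.1 (b i)) (ℓ j) := by
      funext j
      rw [pairing_band_eq_sum hb hbs (hg j) u]
      simp only [hℓ, map_sum, map_mul, eval_C, eval_X]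
    rw [eval_bind₁, ← hfun]
  have hdeg : (bind₁ ℓ P).totalDegree ≤ 4 := (totalDegree_bind₁_le hℓh P).trans hP
  simp_rw [hsub]
  rw [(integrable_eval_coords_of_four hb hbo h4 _ hdeg).2]
  refine hy.2 _ hdeg (fun x _ => ?_) ?_
  · obtain ⟨u, hu, hux, -⟩ := exists_level_of_coords hb hbo x
    rw [← hux, ← hsub u]
    exact hpos u hu
  · obtain ⟨u, hu, hne⟩ := hex
    exact ⟨fun i => Torus.pairing u.1 (b i), Set.mem_univ _, by rwa [← hsub u]⟩

end Summit.AnomalousDissipation.AnomalousDissipation.Theorems.MomentParityQuarticGate
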